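import Literature.MathematicalPhysics.QuantumFieldTheory.Federbush1986.LinearCascadePlaquette
import Literature.MathematicalPhysics.QuantumFieldTheory.Federbush1986.LatticeActionLimit

/-!
# `Federbush1986.PlaquetteAverageV` — the Lie-algebra-valued plaquette functional (1.13): Green form, sup bound under a
# radial envelope, and the pointwise limit `P_s(⌊x/ℓ_s⌋; μ, ν)/ℓ_s² → F_μν(x)`; the `V`-valued port of `LatticeActionLimit`
# §2–§4 for the assembly of [Federbush1987PhaseCellVI] Theorem 2 (reading of record `Theorem2Oriented`)

statement-level skeleton of published theorems with citation tags; proofs where landed; nothing here is a claim about the Yang–Mills mass gap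

CITATION HEADER.  P. Federbush, *A phase cell approach to Yang–Mills theory. VI. Non-abelian lattice-continuum duality*,
Ann. Inst. H. Poincaré **47** (1987) 17–23 [Federbush1987PhaseCellVI], (10) p. 20 («S^r_0 = ¼Σ_p|g_∂p|²») and Theorem 2
p. 20 («the corresponding lattice actions, S^r_0, converge to the continuum action [½∫(dA + A∧A)², p. 18] as r → ∞»);
P. Federbush, *… I*, Commun. Math. Phys. **107** (1986) 319–329 [Federbush1986PhaseCellI], (1.12)–(1.14) p. 324 (the
continuum plaquette functional).  Unit `lit-balaban-r17` gen 4 (fold owner of the Federbush block); SKELETON row **F6.Thm2**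
of `run/shared/lean/pub/lit-balaban/lit-balaban-r17/SKELETON-r17.md` (Phase-2 split of record: r17 abelian analysis, r19
non-abelian plaquette expansion; HOME/STATUS 2026-08-21T05:13Z/05:20Z/05:54Z).

THE MATHEMATICS.  For a `C¹` potential `A` with values in a complete normed space `V` (the Lie algebra 𝔤) the `V`-valued
plaquette functional `P_s(p) = ∫_{u∈[0,1]⁴}∮_{□(src p + ℓ_s u)}A` (`plaqFunctionalV`, `LinearCascadePlaquette`) is, by Green's
identity on every translate (`PlaquetteStokes.loop_eq_integral_curl`, stated there for any normed value space), the
plaquette average `∫_{u}∫₀^ℓ∫₀^ℓ F_μν(src + ℓu + σu_μ + τu_ν)` of the ABELIAN curvature `F_μν = ∂_μA_ν − ∂_νA_μ`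
(`curlV`).  Hence: `‖P_s(p)‖ ≤ ℓ²·sup‖F‖` over the sample points (all within `6ℓ` of every point of the lattice box of `p`,
`norm_samplePt_sub_le` of `LatticeActionLimit`); `P_s(⌊x/ℓ_s⌋;μ,ν)/ℓ_s² → F_μν(x)` by continuity; and under an antitone
radial envelope `‖F_μν(y)‖ ≤ g(‖y‖)` one has `‖P_s(⌊x/ℓ⌋;μ,ν)‖ ≤ g(‖x‖−6)ℓ_s²`.  With r19's plaquette expansion
`|g_∂p| = ‖P_r(p) + ℓ_r²[A_μ, A_ν](x_p)‖ + O(ℓ_r³·env)` and `LatticeRiemann.tendsto_latticeSum_of_dominated` these are the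
pointwise-limit and domination inputs of «S^r_0 → ½∫Σ_{μ<ν}‖F_μν + [A_μ,A_ν]‖²».

WHAT THIS MODULE PROVIDES (plumbing defs `curlV`, `plaqAvgV`; no `Prop` definition, no named fact; axioms standard):
`continuous_curlV`, **`plaqFunctionalV_eq_plaqAvgV`** (Green, 𝔤-valued), `plaqAvgV_const`, `plaqAvgV_sub`,
**`norm_plaqAvgV_le`**, **`tendsto_plaqAvgV_div_sq`**, **`tendsto_plaqFunctionalV_div_sq`**,
**`norm_plaqFunctionalV_le_of_envelope`**.
-/

namespace Literature.MathematicalPhysics.QuantumFieldTheory.Federbush1986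

noncomputable section

open MeasureTheory Filter Set intervalIntegral
open scoped Topology BigOperators

/-! ## The `V`-valued plaquette average: Green form, sup bound, pointwise limit (port of `LatticeActionLimit` §2–§4) -/

section PlaqAvgV

open scoped Interval

variable {V : Type*} [NormedAddCommGroup V]

/-- For fixed `u, σ`, the sample integrand is continuous in `τ`. [folklore] -/
private theorem continuous_layerV₃ {h : E4 → V} (hc : Continuous h) (x : E4) (μ ν : Fin 4) (ℓ : ℝ) (u : Fin 4 → ℝ)
    (σ : ℝ) : Continuous fun τ : ℝ => h (x + ℓ • mkPt u + σ • unitVec μ + τ • unitVec ν) :=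
  hc.comp (continuous_const.add (continuous_id.smul continuous_const))

variable [NormedSpace ℝ V]

/-- `F_μν = ∂_μA_ν − ∂_νA_μ` with values in `V` (the abelian part of the curvature in `contActionDensity`).
[cite: Federbush1987PhaseCellVI, p. 18 («½∫(dA + A∧A)²»), Theorem 2 p. 20] -/
def curlV (A : E4 → Fin 4 → V) (μ ν : Fin 4) (x : E4) : V :=
  fderiv ℝ (fun y => A y ν) x (unitVec μ) - fderiv ℝ (fun y => A y μ) x (unitVec ν)

/-- `F_μν` of a `C¹` potential is continuous. [cite: Federbush1987PhaseCellVI, Theorem 2 p. 20] -/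
theorem continuous_curlV {A : E4 → Fin 4 → V} (hA : ContDiff ℝ 1 A) (μ ν : Fin 4) : Continuous (curlV A μ ν) := by
  have hAc : ∀ i, ContDiff ℝ 1 (fun y => A y i) := fun i => contDiff_pi.1 hA i
  unfold curlV
  exact (((hAc ν).continuous_fderiv one_ne_zero).clm_apply continuous_const).sub
    (((hAc μ).continuous_fderiv one_ne_zero).clm_apply continuous_const)

/-- The `V`-valued plaquette average `∫_{u∈[0,1]⁴}∫₀^ℓ∫₀^ℓ h(x + ℓu + σu_μ + τu_ν)` (weight `χ_p` of I (1.14) applied to `h`,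
up to `ℓ²`). [cite: Federbush1986PhaseCellI, (1.12)–(1.14) p. 324; Federbush1987PhaseCellVI, (10) p. 20] -/
def plaqAvgV (h : E4 → V) (x : E4) (μ ν : Fin 4) (ℓ : ℝ) : V :=
  ∫ u in Icc (0 : Fin 4 → ℝ) 1, ∫ σ in (0 : ℝ)..ℓ, ∫ τ in (0 : ℝ)..ℓ,
    h (x + ℓ • mkPt u + σ • unitVec μ + τ • unitVec ν)

/-- **(1.13) = smeared curvature, `V`-valued**: `P_s(p) = plaqAvgV F_{μν}` (Green on every translate of the plaquette).
[cite: Federbush1986PhaseCellI, (1.12)–(1.14) p. 324; Federbush1987PhaseCellVI, (7) p. 19, (10) p. 20] -/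
theorem plaqFunctionalV_eq_plaqAvgV {A : E4 → Fin 4 → V} (hA : ContDiff ℝ 1 A) {s : ℕ} (p : Plaq s) :
    plaqFunctionalV s A p = plaqAvgV (curlV A p.dir₁ p.dir₂) p.src p.dir₁ p.dir₂ (latLen s) := by
  unfold plaqFunctionalV plaqAvgV
  refine setIntegral_congr_fun measurableSet_Icc fun u _ => ?_
  unfold loopIntV lineIntV
  rw [PlaquetteStokes.loop_eq_integral_curl A hA]
  rfl

/-- [folklore] -/
private theorem continuous_mkPt₆ : Continuous fun u : Fin 4 → ℝ => (mkPt u : E4) := by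
  unfold mkPt; exact PiLp.continuous_toLp 2 _

/-- The innermost layer is continuous in `(u, σ)`. [folklore] -/
private theorem continuous_layerV₂ {h : E4 → V} (hc : Continuous h) (x : E4) (μ ν : Fin 4) (ℓ : ℝ) :
    Continuous fun q : (Fin 4 → ℝ) × ℝ =>
      ∫ τ in (0 : ℝ)..ℓ, h (x + ℓ • mkPt q.1 + q.2 • unitVec μ + τ • unitVec ν) := by
  refine intervalIntegral.continuous_parametric_intervalIntegral_of_continuous'
    (f := fun (q : (Fin 4 → ℝ) × ℝ) (τ : ℝ) => h (x + ℓ • mkPt q.1 + q.2 • unitVec μ + τ • unitVec ν)) ?_ 0 ℓ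
  refine hc.comp ?_
  refine ((continuous_const.add ?_).add ?_).add ?_
  · exact ((continuous_mkPt₆.comp (continuous_fst.comp continuous_fst)).const_smul ℓ)
  · exact (continuous_snd.comp continuous_fst).smul continuous_const
  · exact continuous_snd.smul continuous_const

/-- The middle layer is continuous in `u`. [folklore] -/
private theorem continuous_layerV₁ {h : E4 → V} (hc : Continuous h) (x : E4) (μ ν : Fin 4) (ℓ : ℝ) :
    Continuous fun u : Fin 4 → ℝ =>
      ∫ σ in (0 : ℝ)..ℓ, ∫ τ in (0 : ℝ)..ℓ, h (x + ℓ • mkPt u + σ • unitVec μ + τ • unitVec ν) :=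
  intervalIntegral.continuous_parametric_intervalIntegral_of_continuous'
    (f := fun (u : Fin 4 → ℝ) (σ : ℝ) => ∫ τ in (0 : ℝ)..ℓ, h (x + ℓ • mkPt u + σ • unitVec μ + τ • unitVec ν))
    (continuous_layerV₂ hc x μ ν ℓ) 0 ℓ

/-- For fixed `u`, the `σ`-layer is continuous. [folklore] -/
private theorem continuous_layerV₂' {h : E4 → V} (hc : Continuous h) (x : E4) (μ ν : Fin 4) (ℓ : ℝ) (u : Fin 4 → ℝ) :
    Continuous fun σ : ℝ => ∫ τ in (0 : ℝ)..ℓ, h (x + ℓ • mkPt u + σ • unitVec μ + τ • unitVec ν) := by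
  refine intervalIntegral.continuous_parametric_intervalIntegral_of_continuous'
    (f := fun (σ : ℝ) (τ : ℝ) => h (x + ℓ • mkPt u + σ • unitVec μ + τ • unitVec ν)) ?_ 0 ℓ
  refine hc.comp ?_
  exact ((continuous_const.add (continuous_fst.smul continuous_const)).add (continuous_snd.smul continuous_const))

/-- `vol([0,1]⁴) = 1`. [folklore] -/
private theorem volume_real_unitCube₆ : volume.real (Icc (0 : Fin 4 → ℝ) 1) = 1 := by
  rw [measureReal_def, Real.volume_Icc_pi_toReal (zero_le_one)]
  simp

/-- `plaqAvgV` of a constant: `ℓ² • c`. [cite: Federbush1986PhaseCellI, (1.14) p. 324] -/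
theorem plaqAvgV_const [CompleteSpace V] (c : V) (x : E4) (μ ν : Fin 4) (ℓ : ℝ) :
    plaqAvgV (fun _ => c) x μ ν ℓ = ℓ ^ 2 • c := by
  unfold plaqAvgV
  simp only [intervalIntegral.integral_const, sub_zero, setIntegral_const, volume_real_unitCube₆, smul_smul]
  rw [sq, one_mul]

/-- `plaqAvgV` is additive under subtraction of continuous functions. [cite: Federbush1986PhaseCellI, (1.14) p. 324] -/
theorem plaqAvgV_sub {h₁ h₂ : E4 → V} (hc₁ : Continuous h₁) (hc₂ : Continuous h₂) (x : E4) (μ ν : Fin 4) (ℓ : ℝ) :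
    plaqAvgV (fun y => h₁ y - h₂ y) x μ ν ℓ = plaqAvgV h₁ x μ ν ℓ - plaqAvgV h₂ x μ ν ℓ := by
  unfold plaqAvgV
  have e₃ : ∀ (u : Fin 4 → ℝ) (σ : ℝ),
      (∫ τ in (0 : ℝ)..ℓ, (h₁ (x + ℓ • mkPt u + σ • unitVec μ + τ • unitVec ν)
          - h₂ (x + ℓ • mkPt u + σ • unitVec μ + τ • unitVec ν)))
        = (∫ τ in (0 : ℝ)..ℓ, h₁ (x + ℓ • mkPt u + σ • unitVec μ + τ • unitVec ν))
          - ∫ τ in (0 : ℝ)..ℓ, h₂ (x + ℓ • mkPt u + σ • unitVec μ + τ • unitVec ν) :=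
    fun u σ => intervalIntegral.integral_sub
      ((continuous_layerV₃ hc₁ x μ ν ℓ u σ).intervalIntegrable _ _)
      ((continuous_layerV₃ hc₂ x μ ν ℓ u σ).intervalIntegrable _ _)
  simp_rw [e₃]
  have e₂ : ∀ u : Fin 4 → ℝ,
      (∫ σ in (0 : ℝ)..ℓ, ((∫ τ in (0 : ℝ)..ℓ, h₁ (x + ℓ • mkPt u + σ • unitVec μ + τ • unitVec ν))
          - ∫ τ in (0 : ℝ)..ℓ, h₂ (x + ℓ • mkPt u + σ • unitVec μ + τ • unitVec ν)))
        = (∫ σ in (0 : ℝ)..ℓ, ∫ τ in (0 : ℝ)..ℓ, h₁ (x + ℓ • mkPt u + σ • unitVec μ + τ • unitVec ν))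
          - ∫ σ in (0 : ℝ)..ℓ, ∫ τ in (0 : ℝ)..ℓ, h₂ (x + ℓ • mkPt u + σ • unitVec μ + τ • unitVec ν) :=
    fun u => intervalIntegral.integral_sub
      ((continuous_layerV₂' hc₁ x μ ν ℓ u).intervalIntegrable _ _)
      ((continuous_layerV₂' hc₂ x μ ν ℓ u).intervalIntegrable _ _)
  simp_rw [e₂]
  exact integral_sub ((continuous_layerV₁ hc₁ x μ ν ℓ).continuousOn.integrableOn_compact isCompact_Icc)
    ((continuous_layerV₁ hc₂ x μ ν ℓ).continuousOn.integrableOn_compact isCompact_Icc)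

/-- **Sup bound, `V`-valued**: `‖h‖ ≤ M` at all sample points ⇒ `‖plaqAvgV h‖ ≤ Mℓ²` (`ℓ ≥ 0`).
[cite: Federbush1986PhaseCellI, (1.13)–(1.14) p. 324; Federbush1987PhaseCellVI, (10) p. 20] -/
theorem norm_plaqAvgV_le (h : E4 → V) (x : E4) (μ ν : Fin 4) {ℓ : ℝ} (hℓ : 0 ≤ ℓ) {M : ℝ}
    (hM : ∀ u ∈ Icc (0 : Fin 4 → ℝ) 1, ∀ σ ∈ Icc (0 : ℝ) ℓ, ∀ τ ∈ Icc (0 : ℝ) ℓ,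
      ‖h (x + ℓ • mkPt u + σ • unitVec μ + τ • unitVec ν)‖ ≤ M) :
    ‖plaqAvgV h x μ ν ℓ‖ ≤ M * ℓ ^ 2 := by
  have hI : ∀ {t : ℝ}, t ∈ Ι (0 : ℝ) ℓ → t ∈ Icc (0 : ℝ) ℓ := fun ht => by
    rw [Set.uIoc_of_le hℓ] at ht
    exact ⟨ht.1.le, ht.2⟩
  have h₃ : ∀ u ∈ Icc (0 : Fin 4 → ℝ) 1, ∀ σ ∈ Icc (0 : ℝ) ℓ,
      ‖∫ τ in (0 : ℝ)..ℓ, h (x + ℓ • mkPt u + σ • unitVec μ + τ • unitVec ν)‖ ≤ M * ℓ := by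
    intro u hu σ hσ
    have := intervalIntegral.norm_integral_le_of_norm_le_const (a := (0 : ℝ)) (b := ℓ) (C := M)
      (f := fun τ => h (x + ℓ • mkPt u + σ • unitVec μ + τ • unitVec ν))
      (fun τ hτ => hM u hu σ hσ τ (hI hτ))
    simpa [abs_of_nonneg hℓ] using this
  have h₂ : ∀ u ∈ Icc (0 : Fin 4 → ℝ) 1,
      ‖∫ σ in (0 : ℝ)..ℓ, ∫ τ in (0 : ℝ)..ℓ, h (x + ℓ • mkPt u + σ • unitVec μ + τ • unitVec ν)‖ ≤ M * ℓ * ℓ := by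
    intro u hu
    have := intervalIntegral.norm_integral_le_of_norm_le_const (a := (0 : ℝ)) (b := ℓ) (C := M * ℓ)
      (f := fun σ => ∫ τ in (0 : ℝ)..ℓ, h (x + ℓ • mkPt u + σ • unitVec μ + τ • unitVec ν))
      (fun σ hσ => h₃ u hu σ (hI hσ))
    simpa [abs_of_nonneg hℓ] using this
  have h₁ := norm_setIntegral_le_of_norm_le_const (μ := volume) (s := Icc (0 : Fin 4 → ℝ) 1) (C := M * ℓ * ℓ)
    (f := fun u => ∫ σ in (0 : ℝ)..ℓ, ∫ τ in (0 : ℝ)..ℓ, h (x + ℓ • mkPt u + σ • unitVec μ + τ • unitVec ν))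
    (measure_Icc_lt_top) (fun u hu => h₂ u hu)
  rw [volume_real_unitCube₆, mul_one] at h₁
  unfold plaqAvgV
  calc _ ≤ M * ℓ * ℓ := h₁
    _ = M * ℓ ^ 2 := by ring

/-- [folklore] -/
private theorem tendsto_latLen₆ : Tendsto latLen atTop (𝓝 0) := by
  unfold latLen; exact tendsto_inv_atTop_zero.comp (tendsto_pow_atTop_atTop_of_one_lt one_lt_two)

/-- **The `V`-valued plaquette average of a continuous function, rescaled by `ℓ_s^{−2}`, converges to its value.**
[cite: Federbush1986PhaseCellI, (1.13)–(1.14) p. 324; Federbush1987PhaseCellVI, (10), Theorem 2 p. 20] -/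
theorem tendsto_plaqAvgV_div_sq [CompleteSpace V] {h : E4 → V} (hc : Continuous h) (x : E4) (μ ν : Fin 4) :
    Tendsto (fun s => (latLen s ^ 2)⁻¹ • plaqAvgV h (LatticeRiemann.cornerPt (latLen s)
      (LatticeRiemann.floorIdx (latLen s) x)) μ ν (latLen s)) atTop (𝓝 (h x)) := by
  rw [Metric.tendsto_atTop]
  intro ε hε
  obtain ⟨δ, hδ, hδε⟩ := Metric.continuous_iff.1 hc x (ε / 2) (half_pos hε)
  obtain ⟨N, hN⟩ := (Metric.tendsto_atTop.1 tendsto_latLen₆) (δ / 7) (by positivity)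
  refine ⟨N, fun s hs => ?_⟩
  have hℓ := latLen_pos s
  have hℓδ : latLen s < δ / 7 := by
    have := hN s hs
    rw [Real.dist_eq, sub_zero, abs_of_pos hℓ] at this
    exact this
  set cp := LatticeRiemann.cornerPt (latLen s) (LatticeRiemann.floorIdx (latLen s) x) with hcp
  have key : ‖plaqAvgV h cp μ ν (latLen s) - latLen s ^ 2 • h x‖ ≤ ε / 2 * latLen s ^ 2 := by
    rw [← plaqAvgV_const (h x) cp μ ν (latLen s), ← plaqAvgV_sub hc continuous_const]
    refine norm_plaqAvgV_le _ cp μ ν hℓ.le fun u hu σ hσ τ hτ => ?_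
    have hd : dist (cp + latLen s • mkPt u + σ • unitVec μ + τ • unitVec ν) x < δ := by
      rw [dist_eq_norm]
      calc _ ≤ 6 * latLen s := norm_samplePt_sub_le hℓ x hu hσ hτ μ ν
        _ < δ := by linarith
    have := hδε _ hd
    rw [dist_eq_norm] at this
    exact this.le
  rw [dist_eq_norm]
  have hℓ2 : 0 < latLen s ^ 2 := by positivity
  have : (latLen s ^ 2)⁻¹ • plaqAvgV h cp μ ν (latLen s) - h x
      = (latLen s ^ 2)⁻¹ • (plaqAvgV h cp μ ν (latLen s) - latLen s ^ 2 • h x) := by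
    rw [smul_sub, smul_smul, inv_mul_cancel₀ hℓ2.ne', one_smul]
  rw [this, norm_smul, norm_inv, Real.norm_eq_abs, abs_of_pos hℓ2, inv_mul_lt_iff₀ hℓ2]
  calc _ ≤ ε / 2 * latLen s ^ 2 := key
    _ < latLen s ^ 2 * ε := by nlinarith

/-- **(ii), 𝔤-valued**: `P_s(⌊x/ℓ_s⌋; μ, ν)/ℓ_s² → F_μν(x)` for every `C¹` potential and every `x`.
[cite: Federbush1986PhaseCellI, (1.13)–(1.14) p. 324; Federbush1987PhaseCellVI, (10), Theorem 2 p. 20] -/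
theorem tendsto_plaqFunctionalV_div_sq [CompleteSpace V] {A : E4 → Fin 4 → V} (hA : ContDiff ℝ 1 A) (x : E4)
    (μ ν : Fin 4) :
    Tendsto (fun s => (latLen s ^ 2)⁻¹ • plaqFunctionalV s A ⟨LatticeRiemann.floorIdx (latLen s) x, μ, ν⟩) atTop
      (𝓝 (curlV A μ ν x)) := by
  have := tendsto_plaqAvgV_div_sq (continuous_curlV hA μ ν) x μ ν
  refine this.congr fun s => ?_
  rw [plaqFunctionalV_eq_plaqAvgV hA]
  rfl

/-- **Envelope bound, 𝔤-valued**: under an antitone radial envelope `‖F_μν(y)‖ ≤ g(‖y‖)`, the plaquette functional at the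
box of `x` is `≤ g(‖x‖ − 6)·ℓ_s²`. [cite: Federbush1986PhaseCellI, (1.13)–(1.14) p. 324; Federbush1987PhaseCellVI, Theorem 2
p. 20] -/
theorem norm_plaqFunctionalV_le_of_envelope {A : E4 → Fin 4 → V} (hA : ContDiff ℝ 1 A) {g : ℝ → ℝ} (hg : Antitone g)
    (hdom : ∀ y μ ν, ‖curlV A μ ν y‖ ≤ g ‖y‖) (s : ℕ) (x : E4) (μ ν : Fin 4) :
    ‖plaqFunctionalV s A ⟨LatticeRiemann.floorIdx (latLen s) x, μ, ν⟩‖ ≤ g (‖x‖ - 6) * latLen s ^ 2 := by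
  have hℓ := latLen_pos s
  set b := LatticeRiemann.floorIdx (latLen s) x with hb
  rw [plaqFunctionalV_eq_plaqAvgV hA]
  refine norm_plaqAvgV_le _ _ μ ν hℓ.le fun u hu σ hσ τ hτ => ?_
  refine (hdom _ μ ν).trans (hg ?_)
  have h6 := norm_samplePt_sub_le hℓ x hu hσ hτ μ ν
  rw [← Plaq.src_eq_cornerPt b μ ν] at h6
  have hx : ‖x‖ ≤ ‖(⟨b, μ, ν⟩ : Plaq s).src + latLen s • mkPt u + σ • unitVec μ + τ • unitVec ν - x‖
      + ‖(⟨b, μ, ν⟩ : Plaq s).src + latLen s • mkPt u + σ • unitVec μ + τ • unitVec ν‖ := by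
    have := norm_sub_le ((⟨b, μ, ν⟩ : Plaq s).src + latLen s • mkPt u + σ • unitVec μ + τ • unitVec ν)
      ((⟨b, μ, ν⟩ : Plaq s).src + latLen s • mkPt u + σ • unitVec μ + τ • unitVec ν - x)
    simp only [sub_sub_cancel] at this
    linarith
  have h1 : latLen s ≤ 1 := by
    unfold latLen; exact inv_le_one_of_one_le₀ (one_le_pow₀ (by norm_num))
  change ‖x‖ - 6 ≤ _
  linarith

end PlaqAvgV

end

end Literature.MathematicalPhysics.QuantumFieldTheory.Federbush1986
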